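import Literature.AlgebraicGeometry.Frobenioids.EquivalenceUnitsTransport
import Literature.AlgebraicGeometry.Frobenioids.BaseSectionImage
import HarnessLib

/-!
# Frobenioids I: the image of a base-Frobenius pair under a functor lying over the base
# (Def. 2.7 (iii) "pre-model type" transported along `C₁ → C₂`; tool for [FrdI] Prop. 5.5 (iii))

Mochizuki, *The geometry of Frobenioids I: the general theory*, Kyushu J. Math. **62** (2008)
293–400, kurims text Def. 2.7 (i)–(iii) pp. 51–52, Prop. 5.5 (iii) p. 104 (proof p. 105 ll. 11–20: "In light
of these observations, assertion (iii) for `C^pf` follows immediately from the definitions")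
[cite: MochizukiFrdI2008, Def. 2.7 (iii) p.52].

PROOF-ONLY file (no new definitions).  `BaseSectionImage.lean` / `BaseSectionsOfObjectsCor57Proofs.lean`
(seat abc-iut-L1) transport a base-Frobenius pair `(P, F)` (Def. 2.7 (iii)) along an EQUIVALENCE
`Ψ : C₁ ⥲ C₂` lying over an equivalence of the bases ([FrdI] Cor. 5.7 (i)).  The natural functor
`C → C^pf` of Def. 3.1 (iii) is not an equivalence (unless `C` is of perfect type), so for
Prop. 5.5 (iii) ("if `C` is of … model type, then so is `C^pf`") we need the same "sorting through the
definitions" for a plain functor `G : C₁ → C₂` between pre-Frobenioids over the SAME base `D` such that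

* `G` lies over `D`: `η : Base₂ ∘ G ≅ Base₁`;
* `G` detects objects up to isomorphism: `G A = G A'` only if `A ≅ A'` (for `C → C^pf`, `(A, 1) = (A', 1)`
  forces `A = A'`);
* `G` preserves pull-back morphisms, morphisms of Frobenius type, and Frobenius degrees.

Under these hypotheses the image `{G A}, {G f}` of a base-section `P₁` is a base-section of `C₂`
(`functorImage_isBaseSection`: pull-back arrows; a skeleton — an isomorphism `G A ≅ G A'` inside the image
has `P₁`-distinguished components whose composites lie over identities of `D`, hence ARE identities since
`P₁ ⥲ D` is faithful, so `A ≅ A'` in `P₁` and `A = A'`; Frobenius-trivial objects; `G(P₁) ⥲ D` through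
`P₁ ⥲ D` and `η`), and a `P₁`-Frobenius-section `F₁` transports to `F₂(n)_{G A} := G(F₁(n)_A)`
(`IsBaseFrobeniusPair.functorImage`); in particular `C₁` of pre-model type ⇒ `C₂` of pre-model type
(`IsOfPreModelType.of_functorImage`).  Nothing here is specific to the abc programme; no statement of the
paper is strengthened; no side is taken on [IUTchIII] Cor. 3.12.
-/

namespace Literature.AlgebraicGeometry.Frobenioids

open CategoryTheory Opposite

universe w v v₁ v₂ u u₁ u₂

namespace PreFrobenioid

section FunctorOverBase

variable {D : Type u} [Category.{v} D] {Φ₁ : Dᵒᵖ ⥤ CommMonCat.{w}} {Φ₂ : Dᵒᵖ ⥤ CommMonCat.{w}}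
  {C₁ : Type u₁} [Category.{v₁} C₁] (F₁ : C₁ ⥤ ElemFrobenioid Φ₁)
  {C₂ : Type u₂} [Category.{v₂} C₂] (F₂ : C₂ ⥤ ElemFrobenioid Φ₂)
  (G : C₁ ⥤ C₂)

/-! ### A functor lying over the base: `Base₂(G f)` is the conjugate of `Base₁(f)` by `η` -/

/-- Over the square `η : Base₂ ∘ G ≅ Base₁`, `Base₂(G f) = η_A ≫ Base₁(f) ≫ η_{A'}⁻¹` (stated with the
composite functor, so that all objects are literally `(Base₂ ∘ G)(A)`). [cite: MochizukiFrdI2008, Def. 1.1 (iv) p.20] -/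
theorem comp_baseFunctor_map_eq_conj (η : G ⋙ baseFunctor F₂ ≅ baseFunctor F₁) {A A' : C₁} (f : A ⟶ A') :
    (G ⋙ baseFunctor F₂).map f = η.hom.app A ≫ (baseFunctor F₁).map f ≫ η.inv.app A' := by
  rw [← Category.assoc, ← η.hom.naturality f, Category.assoc, Iso.hom_inv_id_app, Category.comp_id]

/-- Over `η : Base₂ ∘ G ≅ Base₁`, `Base₂(G f) = Base₂(G f')` iff `Base₁ f = Base₁ f'`. [cite: MochizukiFrdI2008, Def. 1.2 (ii) p.21] -/
theorem base_map_eq_iff_of_overBase (η : G ⋙ baseFunctor F₂ ≅ baseFunctor F₁) {A A' : C₁} (f f' : A ⟶ A') :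
    Base F₂ (G.map f) = Base F₂ (G.map f') ↔ Base F₁ f = Base F₁ f' := by
  change (G ⋙ baseFunctor F₂).map f = (G ⋙ baseFunctor F₂).map f' ↔
    (baseFunctor F₁).map f = (baseFunctor F₁).map f'
  rw [comp_baseFunctor_map_eq_conj F₁ F₂ G η f, comp_baseFunctor_map_eq_conj F₁ F₂ G η f',
    NatIso.cancel_natIso_hom_left, NatIso.cancel_natIso_inv_right]

/-- Over `η : Base₂ ∘ G ≅ Base₁`, `G` preserves and reflects base-identity endomorphisms. [cite: MochizukiFrdI2008, Def. 1.2 (ii) p.22] -/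
theorem isBaseIdentity_map_iff_of_overBase (η : G ⋙ baseFunctor F₂ ≅ baseFunctor F₁) {A : C₁} (f : A ⟶ A) :
    IsBaseIdentity F₂ (G.map f) ↔ IsBaseIdentity F₁ f := by
  have h := base_map_eq_iff_of_overBase F₁ F₂ G η f (𝟙 A)
  rw [G.map_id, base_id, base_id] at h
  exact h

/-- `G` maps Frobenius-trivial objects to Frobenius-trivial objects, provided it lies over the base,
preserves morphisms of Frobenius type and preserves Frobenius degrees: transport the section
`ζ : N_{≥1} → End(A)` as `G ∘ ζ`. [cite: MochizukiFrdI2008, Def. 1.2 (iv) p.22] -/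
theorem isFrobeniusTrivial_map_of_overBase (η : G ⋙ baseFunctor F₂ ≅ baseFunctor F₁)
    (hft : ∀ ⦃A B : C₁⦄ (φ : A ⟶ B), IsFrobeniusType F₁ φ → IsFrobeniusType F₂ (G.map φ))
    (hdeg : ∀ ⦃A B : C₁⦄ (φ : A ⟶ B), degFr F₂ (G.map φ) = degFr F₁ φ)
    {A : C₁} (hA : IsFrobeniusTrivial F₁ A) : IsFrobeniusTrivial F₂ (G.obj A) := by
  obtain ⟨ζ, hζ⟩ := hA
  refine ⟨(Functor.mapEnd A G).comp ζ, fun n => ⟨?_, ?_, ?_⟩⟩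
  · show degFr F₂ (G.map (ζ n)) = n
    rw [hdeg, (hζ _).1]
  · show IsBaseIdentity F₂ (G.map (ζ n))
    exact (isBaseIdentity_map_iff_of_overBase F₁ F₂ G η _).mpr (hζ _).2.1
  · show IsFrobeniusType F₂ (G.map (ζ n))
    exact hft _ (hζ _).2.2

/-! ### The image presection of a base-section under `G` -/

variable {P₁ : Presection C₁} {P₂ : Presection C₂}

/-- If `G` detects objects up to isomorphism, two objects of a base-section `P₁` with the same image under
`G` are EQUAL (objects of a base-section isomorphic in `C₁` are equal, `IsBaseSection.eq_of_iso`).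
[cite: MochizukiFrdI2008, Def. 2.7 (i) p.51] -/
theorem IsBaseSection.eq_of_map_obj_eq (hP : IsBaseSection F₁ P₁)
    (hinj : ∀ ⦃A A' : C₁⦄, G.obj A = G.obj A' → Nonempty (A ≅ A')) {A A' : C₁}
    (hA : P₁.obj A) (hA' : P₁.obj A') (h : G.obj A = G.obj A') : A = A' :=
  hP.eq_of_iso F₁ hA hA' (hinj h).some

/-- In the image presection, arrows are pull-back morphisms (Def. 2.7 (i): `P ⊆ C^pl-bk`), since `G`
preserves pull-back morphisms. [cite: MochizukiFrdI2008, Def. 2.7 (i) p.51] -/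
theorem functorImage_hom_pullback (hP : IsBaseSection F₁ P₁)
    (hpb : ∀ ⦃A B : C₁⦄ (φ : A ⟶ B), IsPullbackMorphism F₁ φ → IsPullbackMorphism F₂ (G.map φ))
    (hhom : ∀ ⦃B B' : C₂⦄ (g : B ⟶ B'), P₂.hom g ↔
      ∃ (A A' : C₁) (f : A ⟶ A') (hA : G.obj A = B) (hA' : G.obj A' = B'),
        P₁.hom f ∧ g = eqToHom hA.symm ≫ G.map f ≫ eqToHom hA')
    {B B' : C₂} (g : B ⟶ B') (hg : P₂.hom g) : IsPullbackMorphism F₂ g := by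
  obtain ⟨A, A', f, rfl, rfl, hf, rfl⟩ := (hhom g).mp hg
  simp only [eqToHom_refl, Category.id_comp, Category.comp_id]
  exact hpb _ (hP.hom_pullback f hf)

/-- A `P₁`-distinguished endomorphism lying over the identity of `D` is the identity (`P₁ ⥲ D` is
faithful). [cite: MochizukiFrdI2008, Def. 2.7 (i) p.51] -/
theorem IsBaseSection.eq_id_of_base_eq_id (hP : IsBaseSection F₁ P₁) {A : C₁} (hA : P₁.obj A)
    (f : A ⟶ A) (hf : P₁.hom f) (hb : Base F₁ f = 𝟙 _) : f = 𝟙 A := by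
  haveI := hP.isEquivalence
  let X : P₁.Cat := ⟨A, hA⟩
  let φ : X ⟶ X := ⟨f, hf⟩
  have hφ : φ = 𝟙 X := (P₁.toBase F₁).map_injective (by
    change Base F₁ f = Base F₁ (𝟙 A)
    rw [hb, base_id])
  exact congrArg Subtype.val hφ

/-- The image presection is a skeleton: an isomorphism `G A ≅ G A'` inside the image has
`P₁`-distinguished components `G f`, `G f'` with `G(f' ∘ f) = id`, `G(f ∘ f') = id`; so `f' ∘ f` and
`f ∘ f'` lie over identities of `D`, hence are identities, `A ≅ A'` in `P₁`, and `A = A'`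
(Def. 2.7 (i) (a) for `P₁`). [cite: MochizukiFrdI2008, Def. 2.7 (i) p.51] -/
theorem functorImage_isSkeleton (η : G ⋙ baseFunctor F₂ ≅ baseFunctor F₁) (hP : IsBaseSection F₁ P₁)
    (hinj : ∀ ⦃A A' : C₁⦄, G.obj A = G.obj A' → Nonempty (A ≅ A'))
    (hobj : ∀ B : C₂, P₂.obj B ↔ ∃ A : C₁, P₁.obj A ∧ G.obj A = B)
    (hhom : ∀ ⦃B B' : C₂⦄ (g : B ⟶ B'), P₂.hom g ↔
      ∃ (A A' : C₁) (f : A ⟶ A') (hA : G.obj A = B) (hA' : G.obj A' = B'),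
        P₁.hom f ∧ g = eqToHom hA.symm ≫ G.map f ≫ eqToHom hA') :
    P₂.IsSkeleton := by
  rintro ⟨B, hB⟩ ⟨B', hB'⟩ ⟨e⟩
  obtain ⟨A, hA, rfl⟩ := (hobj B).mp hB
  obtain ⟨A', hA', rfl⟩ := (hobj B').mp hB'
  obtain ⟨A₀, A₀', f, hA₀, hA₀', hf, he⟩ := (hhom e.hom.1).mp e.hom.2
  obtain rfl : A = A₀ := hP.eq_of_map_obj_eq F₁ G hinj hA (P₁.obj_of_hom f hf).1 hA₀.symm
  obtain rfl : A' = A₀' := hP.eq_of_map_obj_eq F₁ G hinj hA' (P₁.obj_of_hom f hf).2 hA₀'.symm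
  obtain ⟨A₁, A₁', f', hA₁, hA₁', hf', he'⟩ := (hhom e.inv.1).mp e.inv.2
  obtain rfl : A' = A₁ := hP.eq_of_map_obj_eq F₁ G hinj hA' (P₁.obj_of_hom f' hf').1 hA₁.symm
  obtain rfl : A = A₁' := hP.eq_of_map_obj_eq F₁ G hinj hA (P₁.obj_of_hom f' hf').2 hA₁'.symm
  simp only [eqToHom_refl, Category.id_comp, Category.comp_id] at he he'
  have h₁ : G.map (f ≫ f') = G.map (𝟙 A) := by
    rw [G.map_comp, ← he, ← he', G.map_id]
    exact congrArg Subtype.val e.hom_inv_id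
  have h₂ : G.map (f' ≫ f) = G.map (𝟙 A') := by
    rw [G.map_comp, ← he, ← he', G.map_id]
    exact congrArg Subtype.val e.inv_hom_id
  have hb₁ : Base F₁ (f ≫ f') = 𝟙 _ := by
    rw [← base_id F₁ A]
    exact (base_map_eq_iff_of_overBase F₁ F₂ G η _ _).mp (congrArg (Base F₂) h₁)
  have hb₂ : Base F₁ (f' ≫ f) = 𝟙 _ := by
    rw [← base_id F₁ A']
    exact (base_map_eq_iff_of_overBase F₁ F₂ G η _ _).mp (congrArg (Base F₂) h₂)
  have hff' : f ≫ f' = 𝟙 A :=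
    hP.eq_id_of_base_eq_id F₁ hA (f ≫ f') (P₁.hom_comp f f' hf hf') hb₁
  have hf'f : f' ≫ f = 𝟙 A' :=
    hP.eq_id_of_base_eq_id F₁ hA' (f' ≫ f) (P₁.hom_comp f' f hf' hf) hb₂
  let X : P₁.Cat := ⟨A, hA⟩
  let X' : P₁.Cat := ⟨A', hA'⟩
  have hXX' : X = X' := hP.isSkeleton X X' ⟨Presection.isoMk P₁ ⟨f, f', hff', hf'f⟩ hf hf'⟩
  obtain rfl : A = A' := congrArg Subtype.val hXX'
  rfl

/-- The image presection is equivalent to `D` via `Base₂`: faithful and full from `P₁ ⥲ D` and `η`,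
essentially surjective from `P₁ ⥲ D` and `η`. [cite: MochizukiFrdI2008, Def. 2.7 (i) p.51] -/
theorem functorImage_toBase_isEquivalence (η : G ⋙ baseFunctor F₂ ≅ baseFunctor F₁)
    (hP : IsBaseSection F₁ P₁)
    (hinj : ∀ ⦃A A' : C₁⦄, G.obj A = G.obj A' → Nonempty (A ≅ A'))
    (hobj : ∀ B : C₂, P₂.obj B ↔ ∃ A : C₁, P₁.obj A ∧ G.obj A = B)
    (hhom : ∀ ⦃B B' : C₂⦄ (g : B ⟶ B'), P₂.hom g ↔
      ∃ (A A' : C₁) (f : A ⟶ A') (hA : G.obj A = B) (hA' : G.obj A' = B'),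
        P₁.hom f ∧ g = eqToHom hA.symm ≫ G.map f ≫ eqToHom hA') :
    (P₂.toBase F₂).IsEquivalence := by
  haveI := hP.isEquivalence
  refine { faithful := ⟨fun {X Y} g g' h => ?_⟩, full := ⟨fun {X Y} d => ?_⟩, essSurj := ⟨fun Y => ?_⟩ }
  · -- faithful
    obtain ⟨B, hB⟩ := X
    obtain ⟨B', hB'⟩ := Y
    obtain ⟨A, hA, rfl⟩ := (hobj B).mp hB
    obtain ⟨A', hA', rfl⟩ := (hobj B').mp hB'
    apply Presection.hom_ext
    obtain ⟨A₀, A₀', f, hA₀, hA₀', hf, hg⟩ := (hhom g.1).mp g.2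
    obtain ⟨A₁, A₁', f', hA₁, hA₁', hf', hg'⟩ := (hhom g'.1).mp g'.2
    obtain rfl : A = A₀ := hP.eq_of_map_obj_eq F₁ G hinj hA (P₁.obj_of_hom f hf).1 hA₀.symm
    obtain rfl : A' = A₀' := hP.eq_of_map_obj_eq F₁ G hinj hA' (P₁.obj_of_hom f hf).2 hA₀'.symm
    obtain rfl : A = A₁ := hP.eq_of_map_obj_eq F₁ G hinj hA (P₁.obj_of_hom f' hf').1 hA₁.symm
    obtain rfl : A' = A₁' := hP.eq_of_map_obj_eq F₁ G hinj hA' (P₁.obj_of_hom f' hf').2 hA₁'.symm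
    simp only [eqToHom_refl, Category.id_comp, Category.comp_id] at hg hg'
    have h' : Base F₂ g.1 = Base F₂ g'.1 := h
    rw [hg, hg', base_map_eq_iff_of_overBase F₁ F₂ G η] at h'
    let X₁ : P₁.Cat := ⟨A, hA⟩
    let X₁' : P₁.Cat := ⟨A', hA'⟩
    let φ : X₁ ⟶ X₁' := ⟨f, hf⟩
    let φ' : X₁ ⟶ X₁' := ⟨f', hf'⟩
    have hφ : φ = φ' := (P₁.toBase F₁).map_injective h'
    rw [hg, hg']
    exact congrArg (fun ψ : X₁ ⟶ X₁' => G.map ψ.1) hφ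
  · -- full
    obtain ⟨B, hB⟩ := X
    obtain ⟨B', hB'⟩ := Y
    obtain ⟨A, hA, rfl⟩ := (hobj B).mp hB
    obtain ⟨A', hA', rfl⟩ := (hobj B').mp hB'
    change (G ⋙ baseFunctor F₂).obj A ⟶ (G ⋙ baseFunctor F₂).obj A' at d
    let X₁ : P₁.Cat := ⟨A, hA⟩
    let X₁' : P₁.Cat := ⟨A', hA'⟩
    -- conjugate `d` into `Base₁ A ⟶ Base₁ A'` and lift it along the full functor `P₁ → D`
    let d₁ : (P₁.toBase F₁).obj X₁ ⟶ (P₁.toBase F₁).obj X₁' := η.inv.app A ≫ d ≫ η.hom.app A'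
    obtain ⟨f₁, hf₁⟩ : ∃ f₁ : X₁ ⟶ X₁', (P₁.toBase F₁).map f₁ = d₁ :=
      ⟨_, (P₁.toBase F₁).map_preimage d₁⟩
    refine ⟨⟨G.map f₁.1, (hhom _).mpr ⟨A, A', f₁.1, rfl, rfl, f₁.2, by simp⟩⟩, ?_⟩
    change (G ⋙ baseFunctor F₂).map f₁.1 = d
    have h1 : (baseFunctor F₁).map f₁.1 = d₁ := hf₁
    rw [comp_baseFunctor_map_eq_conj F₁ F₂ G η f₁.1, h1]
    show η.hom.app A ≫ (η.inv.app A ≫ d ≫ η.hom.app A') ≫ η.inv.app A' = d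
    simp only [Category.assoc, Iso.hom_inv_id_app_assoc, Iso.hom_inv_id_app, Category.comp_id]
  · -- essentially surjective
    let X₀ : P₁.Cat := (P₁.toBase F₁).objPreimage Y
    refine ⟨⟨G.obj X₀.1, (hobj _).mpr ⟨X₀.1, X₀.2, rfl⟩⟩, ⟨?_⟩⟩
    exact (η.app X₀.1).trans ((P₁.toBase F₁).objObjPreimageIso Y)

/-- **The image of a base-section under a functor lying over the base is a base-section** (Def. 2.7 (i)),
provided the functor detects objects up to isomorphism and preserves pull-back morphisms, morphisms of
Frobenius type and Frobenius degrees. [cite: MochizukiFrdI2008, Def. 2.7 (i) p.51] -/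
theorem functorImage_isBaseSection (η : G ⋙ baseFunctor F₂ ≅ baseFunctor F₁) (hP : IsBaseSection F₁ P₁)
    (hinj : ∀ ⦃A A' : C₁⦄, G.obj A = G.obj A' → Nonempty (A ≅ A'))
    (hpb : ∀ ⦃A B : C₁⦄ (φ : A ⟶ B), IsPullbackMorphism F₁ φ → IsPullbackMorphism F₂ (G.map φ))
    (hft : ∀ ⦃A B : C₁⦄ (φ : A ⟶ B), IsFrobeniusType F₁ φ → IsFrobeniusType F₂ (G.map φ))
    (hdeg : ∀ ⦃A B : C₁⦄ (φ : A ⟶ B), degFr F₂ (G.map φ) = degFr F₁ φ)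
    (hobj : ∀ B : C₂, P₂.obj B ↔ ∃ A : C₁, P₁.obj A ∧ G.obj A = B)
    (hhom : ∀ ⦃B B' : C₂⦄ (g : B ⟶ B'), P₂.hom g ↔
      ∃ (A A' : C₁) (f : A ⟶ A') (hA : G.obj A = B) (hA' : G.obj A' = B'),
        P₁.hom f ∧ g = eqToHom hA.symm ≫ G.map f ≫ eqToHom hA') :
    IsBaseSection F₂ P₂ := by
  refine ⟨fun g hg => functorImage_hom_pullback F₁ F₂ G hP hpb hhom g hg,
    functorImage_isSkeleton F₁ F₂ G η hP hinj hobj hhom, fun B hB => ?_,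
    functorImage_toBase_isEquivalence F₁ F₂ G η hP hinj hobj hhom⟩
  obtain ⟨A, hA, rfl⟩ := (hobj B).mp hB
  exact isFrobeniusTrivial_map_of_overBase F₁ F₂ G η hft hdeg (hP.isFrobeniusTrivial A hA)

/-- Transporting a family of endomorphisms `c_A ∈ End(A)`, `A ∈ Ob(P₁)`, along `G` does not depend on the
chosen preimage in `P₁` (two preimages in `P₁` of the same object are equal).
[cite: MochizukiFrdI2008, Def. 2.7 (ii) p.51] -/
theorem functorImage_component_eq (hP : IsBaseSection F₁ P₁)
    (hinj : ∀ ⦃A A' : C₁⦄, G.obj A = G.obj A' → Nonempty (A ≅ A'))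
    (c : ∀ A : C₁, P₁.obj A → (A ⟶ A)) {A A₀ : C₁}
    {B : C₂} (hA : P₁.obj A) (hA₀ : P₁.obj A₀) (h : G.obj A = B) (h₀ : G.obj A₀ = B) :
    eqToHom h₀.symm ≫ G.map (c A₀ hA₀) ≫ eqToHom h₀ = eqToHom h.symm ≫ G.map (c A hA) ≫ eqToHom h := by
  subst h
  obtain rfl : A = A₀ := hP.eq_of_map_obj_eq F₁ G hinj hA hA₀ h₀.symm
  rfl

/-! ### The image of a base-Frobenius pair -/

/-- **The image of a base-Frobenius pair `(P₁, F₁)` under a functor `G` lying over the base** which detects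
objects up to isomorphism and preserves pull-back morphisms, morphisms of Frobenius type and Frobenius
degrees: the base-Frobenius pair `(G(P₁), F₂)` of `C₂` with `F₂(n)_{G A} = G(F₁(n)_A)` (Def. 2.7 (iii);
the "immediately from the definitions" of the pre-model clause of Prop. 5.5 (iii)).
[cite: MochizukiFrdI2008, Def. 2.7 (iii) p.52] -/
theorem IsBaseFrobeniusPair.functorImage (η : G ⋙ baseFunctor F₂ ≅ baseFunctor F₁)
    (hinj : ∀ ⦃A A' : C₁⦄, G.obj A = G.obj A' → Nonempty (A ≅ A'))
    (hpb : ∀ ⦃A B : C₁⦄ (φ : A ⟶ B), IsPullbackMorphism F₁ φ → IsPullbackMorphism F₂ (G.map φ))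
    (hft : ∀ ⦃A B : C₁⦄ (φ : A ⟶ B), IsFrobeniusType F₁ φ → IsFrobeniusType F₂ (G.map φ))
    (hdeg : ∀ ⦃A B : C₁⦄ (φ : A ⟶ B), degFr F₂ (G.map φ) = degFr F₁ φ)
    {Fr₁ : ℕ+ →* End P₁.ι} (hPF : IsBaseFrobeniusPair F₁ P₁ Fr₁) :
    ∃ (P₂ : Presection C₂) (Fr₂ : ℕ+ →* End P₂.ι) (hobj : ∀ A : C₁, P₁.obj A → P₂.obj (G.obj A)),
      (∀ ⦃A B : C₁⦄ (f : A ⟶ B), P₁.hom f → P₂.hom (G.map f)) ∧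
      IsBaseFrobeniusPair F₂ P₂ Fr₂ ∧
        ∀ (n : ℕ+) (A : C₁) (hA : P₁.obj A),
          G.map ((Fr₁ n).app ⟨A, hA⟩) = (Fr₂ n).app ⟨G.obj A, hobj A hA⟩ := by
  have hP := hPF.isBaseSection
  have hFS := hPF.isFrobeniusSection
  -- the image presection `{G A}, {G f}`
  let P₂ : Presection C₂ :=
    { obj := fun B => ∃ A : C₁, P₁.obj A ∧ G.obj A = B
      hom := fun {B B'} g => ∃ (A A' : C₁) (f : A ⟶ A') (hA : G.obj A = B)
        (hA' : G.obj A' = B'), P₁.hom f ∧ g = eqToHom hA.symm ≫ G.map f ≫ eqToHom hA'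
      obj_of_hom := by
        rintro B B' g ⟨A, A', f, hA, hA', hf, -⟩
        exact ⟨⟨A, (P₁.obj_of_hom f hf).1, hA⟩, ⟨A', (P₁.obj_of_hom f hf).2, hA'⟩⟩
      hom_id := by
        rintro B ⟨A, hA, rfl⟩
        exact ⟨A, A, 𝟙 A, rfl, rfl, P₁.hom_id hA, by simp⟩
      hom_comp := by
        rintro B B' B'' g g' ⟨A, A', f, rfl, rfl, hf, rfl⟩ ⟨A₁, A₁', f', hA₁, rfl, hf', rfl⟩
        obtain rfl : A' = A₁ :=
          hP.eq_of_map_obj_eq F₁ G hinj (P₁.obj_of_hom f hf).2 (P₁.obj_of_hom f' hf').1 hA₁.symm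
        exact ⟨A, A₁', f ≫ f', rfl, rfl, P₁.hom_comp f f' hf hf', by simp⟩ }
  have hobj : ∀ B : C₂, P₂.obj B ↔ ∃ A : C₁, P₁.obj A ∧ G.obj A = B := fun B => Iff.rfl
  have hhom : ∀ ⦃B B' : C₂⦄ (g : B ⟶ B'), P₂.hom g ↔
      ∃ (A A' : C₁) (f : A ⟶ A') (hA : G.obj A = B) (hA' : G.obj A' = B'),
        P₁.hom f ∧ g = eqToHom hA.symm ≫ G.map f ≫ eqToHom hA' := fun B B' g => Iff.rfl
  have hP₂ : IsBaseSection F₂ P₂ :=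
    functorImage_isBaseSection F₁ F₂ G η hP hinj hpb hft hdeg hobj hhom
  -- the components of `F₁`, with their types read in `C₁` (`F₁(k)_A : A ⟶ A`)
  let e : ∀ (k : ℕ+) (A : C₁), P₁.obj A → (A ⟶ A) := fun k A hA => (Fr₁ k).app ⟨A, hA⟩
  have he_deg : ∀ (k : ℕ+) (A : C₁) (hA : P₁.obj A), degFr F₁ (e k A hA) = k :=
    fun k A hA => hFS.degFr_eq k ⟨A, hA⟩
  have he_bi : ∀ (k : ℕ+) (A : C₁) (hA : P₁.obj A), IsBaseIdentity F₁ (e k A hA) :=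
    fun k A hA => hFS.isBaseIdentity k ⟨A, hA⟩
  have he_ft : ∀ (k : ℕ+) (A : C₁) (hA : P₁.obj A), IsFrobeniusType F₁ (e k A hA) :=
    fun k A hA => hFS.isFrobeniusType k ⟨A, hA⟩
  have he_one : ∀ (A : C₁) (hA : P₁.obj A), e 1 A hA = 𝟙 A := fun A hA => by
    show (Fr₁ 1).app ⟨A, hA⟩ = _
    rw [map_one]; rfl
  have he_mul : ∀ (k k' : ℕ+) (A : C₁) (hA : P₁.obj A), e (k * k') A hA = e k' A hA ≫ e k A hA :=
    fun k k' A hA => by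
    show (Fr₁ (k * k')).app ⟨A, hA⟩ = _
    rw [map_mul]; rfl
  have he_nat : ∀ (k : ℕ+) {A A' : C₁} (hA : P₁.obj A) (hA' : P₁.obj A') (f : A ⟶ A'), P₁.hom f →
      f ≫ e k A' hA' = e k A hA ≫ f := fun k A A' hA hA' f hf =>
    (Fr₁ k).naturality (X := ⟨A, hA⟩) (Y := ⟨A', hA'⟩) ⟨f, hf⟩
  -- a preimage in `P₁` of every object of `P₂`
  have hex : ∀ X : P₂.Cat, ∃ A : C₁, P₁.obj A ∧ G.obj A = X.1 := fun X => X.2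
  choose a ha hGa using hex
  -- the transported Frobenius-section: `F₂(m)_X := G(F₁(m)_{a X})`, conjugated into `End(X)`
  let app : ℕ+ → ∀ X : P₂.Cat, (X.1 ⟶ X.1) := fun m X =>
    eqToHom (hGa X).symm ≫ G.map (e m (a X) (ha X)) ≫ eqToHom (hGa X)
  -- its value through any presentation `G A = X`
  have happ : ∀ (m : ℕ+) (X : P₂.Cat) (A : C₁) (hA : P₁.obj A) (hAX : G.obj A = X.1),
      app m X = eqToHom hAX.symm ≫ G.map (e m A hA) ≫ eqToHom hAX :=
    fun m X A hA hAX => functorImage_component_eq F₁ G hP hinj (e m) hA (ha X) hAX (hGa X)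
  let Frn : ℕ+ → End P₂.ι := fun m =>
    { app := app m
      naturality := by
        intro X Y g
        obtain ⟨A, A', f, hA, hA', hf, hg⟩ := (hhom g.1).mp g.2
        have hA₁ : P₁.obj A := (P₁.obj_of_hom f hf).1
        have hA₁' : P₁.obj A' := (P₁.obj_of_hom f hf).2
        show g.1 ≫ app m Y = app m X ≫ g.1
        rw [happ m X A hA₁ hA, happ m Y A' hA₁' hA', hg]
        simp only [Category.assoc, eqToHom_trans_assoc, eqToHom_refl, Category.id_comp]
        rw [← G.map_comp_assoc, he_nat m hA₁ hA₁' f hf, G.map_comp_assoc] }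
  let Fr₂ : ℕ+ →* End P₂.ι :=
    { toFun := Frn
      map_one' := by
        apply NatTrans.ext
        funext X
        show app 1 X = 𝟙 X.1
        obtain ⟨A, hA, hAX⟩ := X.2
        rw [happ 1 X A hA hAX, he_one, CategoryTheory.Functor.map_id]
        simp
      map_mul' := by
        intro m m'
        apply NatTrans.ext
        funext X
        show app (m * m') X = app m' X ≫ app m X
        obtain ⟨A, hA, hAX⟩ := X.2
        rw [happ _ X A hA hAX, happ _ X A hA hAX, happ _ X A hA hAX, he_mul, G.map_comp]
        simp only [Category.assoc, eqToHom_trans_assoc, eqToHom_refl, Category.id_comp] }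
  have hFr₂ : ∀ (m : ℕ+) (X : P₂.Cat) (A : C₁) (hA : P₁.obj A) (hAX : G.obj A = X.1),
      (Fr₂ m).app X = eqToHom hAX.symm ≫ G.map (e m A hA) ≫ eqToHom hAX :=
    fun m X A hA hAX => happ m X A hA hAX
  refine ⟨P₂, Fr₂, fun A hA => ⟨A, hA, rfl⟩, fun A B f hf => ⟨A, B, f, rfl, rfl, hf, by simp⟩,
    ⟨hP₂, ⟨?_, ?_, ?_⟩⟩, ?_⟩
  · -- (a) Frobenius degrees: `deg_Fr(G(F₁(m)_A)) = m`
    intro m X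
    obtain ⟨A, hA, hAX⟩ := X.2
    rw [hFr₂ m X A hA hAX]
    refine (degFr_eqToHom_conj F₂ hAX _).trans ?_
    rw [hdeg, he_deg]
  · -- (b) base-identity, through the square over the base
    intro m X
    obtain ⟨A, hA, hAX⟩ := X.2
    rw [hFr₂ m X A hA hAX]
    exact (isBaseIdentity_eqToHom_conj_iff F₂ hAX _).mpr
      ((isBaseIdentity_map_iff_of_overBase F₁ F₂ G η _).mpr (he_bi _ A hA))
  · -- (b) Frobenius type, preserved by `G`
    intro m X
    obtain ⟨A, hA, hAX⟩ := X.2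
    rw [hFr₂ m X A hA hAX]
    exact (isFrobeniusType_eqToHom_conj_iff F₂ hAX _).mpr (hft _ (he_ft _ A hA))
  · -- `G(F₁(n)_A) = F₂(n)_{G A}`
    intro n A hA
    have h := hFr₂ n ⟨G.obj A, ⟨A, hA, rfl⟩⟩ A hA rfl
    simp only [eqToHom_refl, Category.id_comp, Category.comp_id] at h
    exact h.symm

/-- **Pre-model type is transported along a functor lying over the base** which detects objects up to
isomorphism and preserves pull-back morphisms, morphisms of Frobenius type and Frobenius degrees
(Def. 2.7 (iii)). [cite: MochizukiFrdI2008, Def. 2.7 (iii) p.52] -/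
theorem IsOfPreModelType.of_functorImage (η : G ⋙ baseFunctor F₂ ≅ baseFunctor F₁)
    (hinj : ∀ ⦃A A' : C₁⦄, G.obj A = G.obj A' → Nonempty (A ≅ A'))
    (hpb : ∀ ⦃A B : C₁⦄ (φ : A ⟶ B), IsPullbackMorphism F₁ φ → IsPullbackMorphism F₂ (G.map φ))
    (hft : ∀ ⦃A B : C₁⦄ (φ : A ⟶ B), IsFrobeniusType F₁ φ → IsFrobeniusType F₂ (G.map φ))
    (hdeg : ∀ ⦃A B : C₁⦄ (φ : A ⟶ B), degFr F₂ (G.map φ) = degFr F₁ φ)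
    (h : IsOfPreModelType F₁) : IsOfPreModelType F₂ := by
  obtain ⟨P₁, Fr₁, hPF⟩ := h
  obtain ⟨P₂, Fr₂, -, -, hPF₂, -⟩ := hPF.functorImage F₁ F₂ G η hinj hpb hft hdeg
  exact ⟨P₂, Fr₂, hPF₂⟩

end FunctorOverBase

end PreFrobenioid

end Literature.AlgebraicGeometry.Frobenioids
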